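import Mathlib
import HarnessLib

/-!
# Crux `BirComplexStableXYR`, line `fat-gaussian-defect-calculus`: stub T4 `stub_projectorPowers`

Registered stub (lead c8, wave 12, chapter T-end, skeleton
`Cruxes/BirComplexStableXYR/Lines/fat_gaussian_defect_calculus.lean`), helper (`--supports`) for the crux
`Summit.HubbardSuperconductivity.HubbardSuperconductivity.Theses.BalabanIR.BirComplexStableXYR`:
**the dressed rank-one projector and the power formula** (generic functional analysis, pure algebra in the
ring `E →L[ℂ] E` of bounded operators on a complex normed space `E`; no completeness, no norms).

**Statement.** Let `t : E →L[ℂ] E`, `x : E`, `ψ : E →L[ℂ] ℂ`, `μ : ℂ` with `t x = μ • x` (right eigenvector),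
`ψ ∘ t = μ • ψ` (left eigenvector) and `ψ x ≠ 0`.  Put `p := (ψ x)⁻¹ • ψ(·) x`.  Then `p * p = p`, `t * p = μ • p`,
`p * t = μ • p`, and for every `n ≥ 1`, `t ^ n = μ ^ n • p + ((1 - p) * t * (1 - p)) ^ n`.

**Proof.** The three identities are checked on vectors (`p y = (ψ x)⁻¹ • ψ y • x`, linearity, `ψ (t y) = μ ψ y`).
For the powers: `(1 - p) t (1 - p) = t - μ p` (expand, `p t = t p = μ p`, `p² = p`), and with `a := μ p`,
`b := t - μ p` one has `t = a + b`, `a b = b a = 0`, so `(a + b)ⁿ = aⁿ + bⁿ` for `n ≥ 1` (induction; the cross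
terms `aⁿ b`, `bⁿ a` vanish), while `aⁿ = μⁿ pⁿ = μⁿ p` (`p` idempotent).  Elementary given Mathlib; no definition
and no named fact is introduced; sorry-free. [folklore]
-/

set_option linter.dupNamespace false -- `Summit.<S>.<S>.Theorems…` repeats the summit name (D-0017 layout)

namespace Summit.HubbardSuperconductivity.HubbardSuperconductivity.Theorems.TEnd

open scoped ComplexConjugate

/-- **Orthogonal binomial formula.** In a semiring, if `a * b = 0` and `b * a = 0` then
`(a + b) ^ n = a ^ n + b ^ n` for every `n ≥ 1` (the cross terms vanish). [folklore] -/
theorem hsc_projPow_add_pow {R : Type*} [Semiring R] {a b : R} (hab : a * b = 0) (hba : b * a = 0)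
    (n : ℕ) (hn : 1 ≤ n) : (a + b) ^ n = a ^ n + b ^ n := by
  induction n, hn using Nat.le_induction with
  | base => simp
  | succ n hn ih =>
    obtain ⟨k, rfl⟩ := Nat.exists_eq_add_of_le' hn
    have h1 : a ^ (k + 1) * b = 0 := by rw [pow_succ, mul_assoc, hab, mul_zero]
    have h2 : b ^ (k + 1) * a = 0 := by rw [pow_succ, mul_assoc, hba, mul_zero]
    rw [pow_succ, ih, add_mul, mul_add, mul_add, h1, h2, add_zero, zero_add, ← pow_succ, ← pow_succ]

/-- **Power formula from the projector identities (ring level).** In a complex algebra, if `p * p = p`,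
`t * p = μ • p` and `p * t = μ • p`, then `t ^ n = μ ^ n • p + ((1 - p) * t * (1 - p)) ^ n` for `n ≥ 1`:
`(1 - p) t (1 - p) = t - μ p`, `t = μ p + (t - μ p)` with vanishing mixed products, and `(μ p)ⁿ = μⁿ p`.
[folklore] -/
theorem hsc_projPow_ring {R : Type*} [Ring R] [Algebra ℂ R] (t p : R) (μ : ℂ) (hpp : p * p = p)
    (htp : t * p = μ • p) (hpt : p * t = μ • p) (n : ℕ) (hn : 1 ≤ n) :
    t ^ n = μ ^ n • p + ((1 - p) * t * (1 - p)) ^ n := by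
  have hq : (1 - p) * t * (1 - p) = t - μ • p := by
    rw [sub_mul, one_mul, hpt, mul_sub, mul_one, sub_mul t (μ • p) p, htp, smul_mul_assoc, hpp, sub_self,
      sub_zero]
  have hab : (μ • p) * (t - μ • p) = 0 := by
    rw [mul_sub, smul_mul_assoc, hpt, smul_mul_assoc, mul_smul_comm, hpp, sub_self]
  have hba : (t - μ • p) * (μ • p) = 0 := by
    rw [sub_mul, mul_smul_comm, htp, smul_mul_assoc, mul_smul_comm, hpp, sub_self]
  have hpn : p ^ n = p := IsIdempotentElem.pow_eq hpp (by omega)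
  rw [hq]
  conv_lhs => rw [← add_sub_cancel (μ • p) t]
  rw [hsc_projPow_add_pow hab hba n hn, smul_pow, hpn]

section

variable {E : Type*} [NormedAddCommGroup E] [NormedSpace ℂ E]

/-- **Idempotence:** `p * p = p` for `p = (ψ x)⁻¹ • ψ(·) x` when `ψ x ≠ 0`. [folklore] -/
theorem hsc_projPow_idem (x : E) (ψ : E →L[ℂ] ℂ) (hx : ψ x ≠ 0) :
    ((ψ x)⁻¹ • ψ.smulRight x : E →L[ℂ] E) * ((ψ x)⁻¹ • ψ.smulRight x) = (ψ x)⁻¹ • ψ.smulRight x := by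
  ext y
  simp only [mul_apply_eq_comp, smul_apply, ContinuousLinearMap.smulRight_apply, map_smul, smul_smul]
  congr 1
  field_simp

/-- **Right eigen-relation:** `t * p = μ • p` when `t x = μ • x`. [folklore] -/
theorem hsc_projPow_mul_left (t : E →L[ℂ] E) (x : E) (ψ : E →L[ℂ] ℂ) (μ : ℂ) (htx : t x = μ • x) :
    t * ((ψ x)⁻¹ • ψ.smulRight x) = μ • ((ψ x)⁻¹ • ψ.smulRight x) := by
  ext y
  simp only [mul_apply_eq_comp, smul_apply, ContinuousLinearMap.smulRight_apply, map_smul, htx, smul_smul]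
  congr 1
  ring

/-- **Left eigen-relation:** `p * t = μ • p` when `ψ ∘ t = μ • ψ`. [folklore] -/
theorem hsc_projPow_mul_right (t : E →L[ℂ] E) (x : E) (ψ : E →L[ℂ] ℂ) (μ : ℂ) (hψt : ψ.comp t = μ • ψ) :
    ((ψ x)⁻¹ • ψ.smulRight x : E →L[ℂ] E) * t = μ • ((ψ x)⁻¹ • ψ.smulRight x) := by
  ext y
  have h : ψ (t y) = μ * ψ y := by
    have := DFunLike.congr_fun hψt y
    simpa using this
  simp only [mul_apply_eq_comp, smul_apply, ContinuousLinearMap.smulRight_apply, h, smul_smul]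
  congr 1
  ring

end

/-- **stub T4 (M, generic; pure algebra): the dressed rank-one projector and the power formula.**  If
`t x = μx`, `ψ∘t = μψ` and `ψ(x) ≠ 0` then `p = ψ(x)⁻¹·ψ(·)x` is idempotent, `tp = pt = μp`, and for `n ≥ 1`:
`tⁿ = μⁿp + ((1−p)t(1−p))ⁿ` (the cross terms of `(μp + (t − μp))ⁿ` vanish, and `(1−p)t(1−p) = t − μp`).
[folklore] -/
theorem stub_projectorPowers :
    ∀ (E : Type) [NormedAddCommGroup E] [NormedSpace ℂ E]
      (t : E →L[ℂ] E) (x : E) (ψ : E →L[ℂ] ℂ) (μ : ℂ), t x = μ • x → ψ.comp t = μ • ψ → ψ x ≠ 0 →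
        let p : E →L[ℂ] E := (ψ x)⁻¹ • ψ.smulRight x
        p * p = p ∧ t * p = μ • p ∧ p * t = μ • p ∧
        ∀ n : ℕ, 1 ≤ n → t ^ n = μ ^ n • p + (((1 : E →L[ℂ] E) - p) * t * ((1 : E →L[ℂ] E) - p)) ^ n := by
  intro E _ _ t x ψ μ htx hψt hψx p
  have hpp : p * p = p := hsc_projPow_idem x ψ hψx
  have htp : t * p = μ • p := hsc_projPow_mul_left t x ψ μ htx
  have hpt : p * t = μ • p := hsc_projPow_mul_right t x ψ μ hψt
  exact ⟨hpp, htp, hpt, fun n hn => hsc_projPow_ring t p μ hpp htp hpt n hn⟩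

end Summit.HubbardSuperconductivity.HubbardSuperconductivity.Theorems.TEnd
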